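import Summits.QuantumFields.YangMills.Theorems.BalabanLadderIRDefectSquaringSharp
import Summits.QuantumFields.YangMills.Theorems.BalabanLadderIRColdPurityBridgeRungs
import Summits.QuantumFields.YangMills.Theorems.BalabanLadderIRLevelDescentLemma
import Summits.QuantumFields.YangMills.Theorems.BalabanLadderIRPurityClimb24
import Summits.QuantumFields.YangMills.Theorems.BalabanLadderIRPurityClimbUniform
import Summits.QuantumFields.YangMills.Theorems.BalabanLadderIRThermalRatchetSeam
import HarnessLib

/-!
# Line `thermal-ratchet` (ideator ym-ir-idea-11 g0, LINE 2, lens «finite»: reduction-to-finite — theorem first, computation second)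
## crux `BalabanLadder.IR` (stmt-QuantumFields-19354, rung R2c) — the β-uniformity of the infrared leg carried by a SIGN
## (β-monotonicity of the cold purity defect at fixed lattice size = positivity of the finite-volume thermal plaquette excess),
## the Yang–Mills content left as COFINAL DECIDABLE INSTANCES handed DOWN in β

HONEST FRAMING.  Nothing in this file proves the Yang–Mills mass gap (Clay) or the crux `IR`; R4 (`BalabanUVStability4`) closes
only the conditional finite-𝕋⁴ rung `BalabanLadder.UV`.  Conditional skeleton: four `stub_*` obligations (two new typed Props + the
pincer's `AFToColdPressure` and the residual `IRnsc` BY NAME; rev 4: the registered sign stub is BASIN HEREDITY `BasinHereditySC` = the threshold form of the ratchet at depth 2⁻²⁴, with M ⇒ M_c ⇒ M♭ proved) and a kernel-checked composition `IR_of` concluding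
`Summit.QuantumFields.YangMills.Theses.BalabanLadder.IR` by name; the seam `coldPressureOnsetSC_of_ratchet` is PROVED (sorry-free) over
the landed bootstrap R in its SHARP form (`AspectBootstrap.coldDefect_sq_le_two_pow`, C = 2²⁰, basin 2⁻²⁴; rev 2 after crit-3 P3).

THE LINE (currency: the cold purity defect `δᶜ_β(L) = coldDefect r.ρ β L`, `L³ × 2⌊L/4⌋` vs `L³ × ⌊L/4⌋`; NO ruler, NO exit stub):

  IR ⇐ M ∧ CERT♭ ∧ X_cp ∧ N,  where

* **M = `PurityMonotoneSC`** (the RATCHET; correlation-inequality ∕ sign class, group-blind, NO gap content): beyond some `β₀`, at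
  every FIXED lattice size `L ≥ 8`, `β ↦ δᶜ_β(L)` is non-decreasing — a finer lattice makes the same box physically smaller and hotter,
  hence LESS pure.  Since `∂_β log[Z_β(L³×2t)/Z_β(L³×t)²] = 12 L³ t (⟨P⟩_{L³×2t} − ⟨P⟩_{L³×t})` (`P` = mean plaquette `Re tr U_p/N`),
  M says exactly: THE HOTTER TORUS HAS THE LARGER MEAN PLAQUETTE, `⟨P⟩_{L³×⌊L/4⌋} ≥ ⟨P⟩_{L³×2⌊L/4⌋}` — the lattice form of the
  positivity of the thermal interaction measure `ε − 3p = T⁵∂_T(p/T⁴) ≥ 0` (Boyd et al. 1996: `(ε−3p)/T⁴ = 6N_t⁴ (a dβ/da)(P₀ − P_T)` with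
  `a dβ/da < 0`), asserted by every lattice thermodynamics computation and proved by no one.  It holds for free fields (zero-mode
  counting; the Casimir energies are β-independent and cancel — in the purity RATIO the vacuum energy cancels identically, only GAPS
  enter), in the strong-coupling window (positive character coefficients), and in the exactly solvable 2D member (in-session check:
  2D SU(2) Wilson torus, `Z_A = Σ_j (I_{2j+1}(β)/I_1(β))^A`, `S₂(A, β) = 2 log Z_A − log Z_{2A}` non-decreasing in β for
  A ∈ {1,…,128}, β ∈ [0.1, 40], zero violations).  It is TRUE for `U(1)₄` as well — M carries the TRANSPORT, not the confinement.
* **CERT♭ = `CofinalCertificateSC`** (the Yang–Mills content as COFINAL decidable instances): for every `β₁` there is a coupling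
  `β ≥ β₁` and a box `L ≥ 8` certified deep-pure, `δᶜ_β(L) ≤ 2⁻²⁴` (sharp constant, rev 2).  No ruler, no width, no uniformity: any unbounded
  sequence of certified couplings, each with a box of the certifier's choosing.  Weaker BY NAME than the bridge's E = `ColdExitSC`
  (`cofinalCertificate_of_coldExit`) and than LINE 1's CERT = `FSSHandover.DeepCertificateSC` (box `t₀L½ ≥ 8`, tolerance below `2⁻²⁴` in rev 2; one-line proof, kept in the card to keep this workfile independent of LINE 1's module).  FALSE for
  `U(1)₄` (Coulomb phase: `δᶜ ≥ 1 − e^{−26}` at every size) — the non-abelian teeth of the line.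
* **X_cp = `AFToColdPressure`**, **N = `IRnsc`** by name (shared ∕ residual, as in lines 10, 13 and LINE 1).

REV 3 → REV 4 (typing lesson of crit-3's P2, then crit-3 VERDICT-thermal-ratchet K-USE ∕ P1: register exactly what the seam consumes).
The LOAD-BEARING stub is BASIN HEREDITY **M♭ = `BasinHereditySC`** («a 2⁻²⁴-pure L-box at β' is 2⁻²⁴-pure at every β₀ ≤ β ≤ β'»);
the COLD ratchet **M_c = `ColdMonotoneSC`** (monotonicity only where `δᶜ_{β'}(L) ≤ 1/4`) and the full ratchet M are kept as the
conceptual statements with M ⇒ M_c ⇒ M♭ proved (`coldMonotone_of_purityMonotone`, `basinHeredity_of_coldMonotone`); `IR_of` consumes M♭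
(`IR_of_coldMonotone`, `IR_of_purityMonotone` for the stronger forms).  The point: in cold boxes the purity defect is coordinatewise non-decreasing in every torus level weight
(spectral lemma, M_c docstring ∕ card § rev 3), so M_c follows from LEVEL DESCENT alone and never meets the hot 4:1-box crossover,
the one regime where the full M depends on thermal averages (torelon ∕ glueball elasticities).

SEAM (PROVED, three lines): for `β ≥ max β₀ 0` take a certified `(β⋆ ≥ β, L⋆)` from CERT♭ (a certified box is cold: 2⁻²⁴ ≤ 1/4);
the ratchet hands the certificate DOWN:
`δᶜ_β(L⋆) ≤ δᶜ_{β⋆}(L⋆) ≤ 2⁻²⁴`; `coldPressureAt_of_le` (landed R at the sharp C = 2²⁰) gives `ColdPressureAt r.ρ β L⋆`, i.e.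
`ColdPressureOnsetSC`; `IR_of_cp_repaired` concludes.  The cold-pressure LENGTH assigned to β is the box of the next certificate above β —
possibly far too long; that is immaterial: the pincer's pin X speaks of the intrinsic `cpLength`, which is ≤ any admissible length.

WHY THIS LINE (finite lens, strict form).  THEOREM FIRST: `M♭ ∧ X ∧ N ⇒ (cofinal certificates ⇒ IR)` with M♭ a SIGN ∕ heredity statement (no scale,
no rate, no smallness, no group content) — the reduction-to-(cofinal)-finite.  COMPUTATION SECOND: an unbounded sequence of single
inequalities between Haar integrals over finitely many links.  Compared with LINE 1 (`fss-handover`: transport by CONVERGENCE along a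
ruler, needs E½ and a width bound t₀) the ratchet transports by ORDER, needs no ruler, no half-purity stub, no width — at the price that
infinitely many certificates are irreducible here (no effective edition), whereas LINE 1 with an effective U needs one.

WHY NOVEL (searched: census v3.3 §A–§L, lines 1–15 + LINE 1; `lit search` "interaction measure positivity lattice plaquette difference",
"trace anomaly positive finite temperature lattice gauge"; galaxy "interaction measure|trace anomaly|plaquette difference"): no line on the
desk transports in β by a sign; idea-2's `beta-slope-floor` is a β-derivative FLOOR on CORRELATORS integrated UPWARD (Grönwall), this is a
β-derivative SIGN of a FREE-ENERGY RATIO used DOWNWARD from cofinal certificates; idea-7's MONO (retired) was monotonicity in SPATIAL volume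
of a gap; idea-14's staircase is monotonicity in SCALE at one β.  Census B13 (Tomboulis' decimation monotonicity, killed by MK group-blindness)
is the cautionary neighbour: here the monotone quantity is group-blind BY DESIGN and carries no confinement claim — the teeth sit in CERT♭.
bears_on: R2c (`BalabanLadder.IR`, stmt-QuantumFields-19354).

CHEAPEST FALSIFIER (B2, engines; MC-cheap, hours): SU(2), `8³×2` vs `8³×4` and `12³×3` vs `12³×6` at β_W ∈ {1.8, 2.0, 2.2, 2.3, 2.4, 2.6,
2.8}: the sign of `⟨P⟩_hot − ⟨P⟩_cold` (M predicts ≥ 0; magnitudes 10⁻⁴–10⁻² — standard finite-T thermodynamics precision).  KILL: a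
significant (5σ) NEGATIVE difference at any β ≥ 2.2 (beyond the bulk crossover).  Literature anchor to check first (lit seats): Engels–Karsch–
Montvay–Satz 1982 (SU(2) `N_t = 2,3,4` plaquette differences), Boyd et al. hep-lat/9602007 (SU(3)).  Exact anchors: 2D SU(2) (done, holds);
free Maxwell (holds by zero-mode count).  Disproof.lean for 19354: none; negatives (7): none relevant.
-/

set_option autoImplicit false

noncomputable section

open Filter Topology MeasureTheory
open Literature.MathematicalPhysics.QuantumFieldTheory Literature.MathematicalPhysics.QuantumLattice
open Literature.MathematicalPhysics.QuantumFieldTheory.Balaban1983to89.Missing (strongCouplingRadius)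
open Summit.QuantumFields.YangMills.Cruxes.IR.ColdPurityBridge (coldDefect ColdExitSC coldPressureAt_of_exit_recursion
  coldExitSC_strongCoupling FloorToPuritySC)
open Summit.QuantumFields.YangMills.Cruxes.IR.ColdPressurePincer (ColdPressureAt AFToColdPressure IRsc IRnsc
  ColdPressureOnsetSC IRsc_of_cp IR_of_cp_repaired IR_of_cases cpLength cpLength_le gapInUnits_of_coldPressure_pinned)
open Summit.QuantumFields.YangMills.Cruxes.OSLegsFromFemtoAndGap.DlrCollarTransfer (GapInUnits LowerBounds)
open Summit.QuantumFields.YangMills.Cruxes.IR.AspectBootstrap (coldDefect_sq_le_two_pow boxDefect IsAxisSymmetric IsTracePositive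
  HasVolumeBounds coldDefect_eq_boxDefect axisSymmetric tracePositive volumeBounds)

namespace Summit.QuantumFields.YangMills.Cruxes.IR.ThermalRatchet

/-! ## §1 The obligation Props (OPEN; nothing claimed) -/

/-- **M — `PurityMonotoneSC` (the ratchet; crux of the line; sign ∕ correlation-inequality class, NO gap content).**  For compact simple
simply-connected `G` and every lattice representation `r` there is `β₀` such that for all `β₀ ≤ β ≤ β'` and every lattice size `L ≥ 8`,
`δᶜ_β(L) ≤ δᶜ_{β'}(L)`: at fixed lattice size the cold purity defect is non-decreasing in the coupling (finer lattice ⇒ hotter, smaller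
box ⇒ less pure).  Equivalent (β-derivative of `log Z(L³×2t) − 2 log Z(L³×t)`): the mean plaquette of the `L³×⌊L/4⌋` torus is ≥ that of
the `L³×2⌊L/4⌋` torus — finite-volume positivity of the thermal plaquette excess ∕ interaction measure.  Why it might fail: it is a GKS-type
monotonicity for a non-abelian gauge theory, where no correlation inequality is available (`ToronPlaneAnticorrelation` kills product-closed
criteria; B13: decimation monotonicities are MK-blind); near bulk cross-overs (β_W ≈ 2.2 for SU(2); the 0⁺⁺ dip for SU(3) at β ≈ 5.5) finite-size
curves of different shapes may cross and flip the sign for small `L` — whence `∃ β₀`; in hot small boxes the sufficient condition «all torus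
gaps non-increasing in β» does NOT imply M (light states, `E t ≪ 1`), so M is genuinely a statement about thermal averages.  Sources:
Boyd et al. hep-lat/9602007 (integral method, `(ε−3p)/T⁴ ∝ (a dβ/da)(P₀−P_T)`), EngelsKarschMontvaySatz1982 (SU(2) thermodynamics),
Gliozzi hep-lat/0701020 (small-box Stefan–Boltzmann deficits — Casimir terms, which CANCEL in the purity ratio), census B13/B14,
`Literature.Barriers…ToronPlaneAnticorrelation`. -/
def PurityMonotoneSC : Prop :=
  ∀ (G : Type) [Group G] [TopologicalSpace G] [IsTopologicalGroup G] [CompactSpace G],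
    IsCompactSimpleLieGroup G → SimplyConnectedSpace G →
    letI : MeasurableSpace G := borel G
    haveI : BorelSpace G := ⟨rfl⟩
    ∀ r : LatticeRep G, ∃ β₀ : ℝ, ∀ β β' : ℝ, β₀ ≤ β → β ≤ β' → ∀ L : ℕ, 8 ≤ L →
      coldDefect r.ρ β L ≤ coldDefect r.ρ β' L

/-- **M_c — `ColdMonotoneSC` (rev 3: the ratchet RESTRICTED TO COLD BOXES — exactly what the seam consumes; the registered,
load-bearing stub).**  For compact simple simply-connected `G` and every `r` there is `β₀` such that for all `β₀ ≤ β ≤ β'` and every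
`L ≥ 8`: IF the box is cold at the finer coupling, `δᶜ_{β'}(L) ≤ 1/4`, THEN coarsening the lattice does not decrease its purity,
`δᶜ_β(L) ≤ δᶜ_{β'}(L)` (coarser lattice at fixed `L` = physically LARGER and COLDER box).  Weaker than M by name
(`coldMonotone_of_purityMonotone`); it never visits the hot 4:1-box crossover regime, the one place where M is delicate.  WHY `1/4`:
spectral bookkeeping (card § rev 3) — writing `1 − δᶜ = z_{2t}/z_t²`, `z_s = Σ_i n_i μ_i^s` over torus levels `μ_i = e^{−E_i} ≤ 1 = μ_0`,
one has `∂δᶜ/∂μ_j = 2t n_j μ_j^{t−1}(z_{2t} − μ_j^t z_t)/z_t³` and `z_{2t} − μ_j^t z_t ≥ 1 − μ_j^t z_t ≥ 1 − δᶜ z_t³/2 ≥ 1 − 4δᶜ > 0` whenever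
`δᶜ < 1/4` (using `2 n_1 μ_1^t ≤ δᶜ z_t²` and `z_t ≤ 1/(1−δᶜ) ≤ 2`): in cold boxes the purity defect is coordinatewise NON-DECREASING in every
level weight, so M_c follows from LEVEL DESCENT («every torus energy level, in lattice units, is non-increasing in β at fixed L» — true for
glueballs `m·a(β)`, torelons `σa²L`, femto levels `ε_i g^{2/3}(La)/L`, strong-coupling masses `∼ −4 log β`), with no condition on elasticities
or thermal averages.  Why it might fail: a torus level RISING in lattice units with β inside a cold box (a lattice artefact near the bulk
crossover, whence `∃ β₀`), strongly enough to beat the descent of all others.  Sources: as for M; Lüscher 1983 (femto levels), Michael ∕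
Teper torelon systematics (context). -/
def ColdMonotoneSC : Prop :=
  ∀ (G : Type) [Group G] [TopologicalSpace G] [IsTopologicalGroup G] [CompactSpace G],
    IsCompactSimpleLieGroup G → SimplyConnectedSpace G →
    letI : MeasurableSpace G := borel G
    haveI : BorelSpace G := ⟨rfl⟩
    ∀ r : LatticeRep G, ∃ β₀ : ℝ, ∀ β β' : ℝ, β₀ ≤ β → β ≤ β' → ∀ L : ℕ, 8 ≤ L →
      coldDefect r.ρ β' L ≤ 1 / 4 → coldDefect r.ρ β L ≤ coldDefect r.ρ β' L

/-- **M♭ — `BasinHereditySC` (rev 4: THE REGISTERED, LOAD-BEARING SIGN STUB — the threshold form at the basin depth, literally what the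
seam consumes; crit-3 VERDICT-thermal-ratchet K-USE ∕ P1).**  For compact simple simply-connected `G` and every `r` there is `β₀` such that
for all `β₀ ≤ β ≤ β'` and every `L ≥ 8`: a `2⁻²⁴`-pure `L`-box at the finer coupling `β'` is `2⁻²⁴`-pure at the coarser coupling `β`
(«deep purity is inherited DOWN the coupling at fixed lattice size»: the coarser lattice makes the same box physically larger and colder).
Chain of strength (all proved below): M ⇒ M_c ⇒ M♭; and (crit-3, `tame_of_threshold`, given R) M♭ ⇒ idea-12's K2 `ExitScaleTameSC`.
M♭ follows from LEVEL DESCENT exactly as M_c does (spectral lemma, M_c docstring).  Why it might fail: as M_c — a dip-like non-monotonic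
lattice artefact of the dominant torus level recurring at arbitrarily weak coupling (the SU(3) Wilson 0⁺⁺ dip at β ∈ [5.5, 5.8] is the
real instance at intermediate coupling, absorbed by `∃ β₀`).  Group-blind (plausibly true for U(1)₄: vacuous there, no deep-pure box).
Sources: as for M; Boyd et al. hep-lat/9602007; census B13; crit-3 PROBE-thermal-ratchet.lean (`threshold_of_monotone`,
`exitAt_of_threshold_cert`). -/
def BasinHereditySC : Prop :=
  ∀ (G : Type) [Group G] [TopologicalSpace G] [IsTopologicalGroup G] [CompactSpace G],
    IsCompactSimpleLieGroup G → SimplyConnectedSpace G →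
    letI : MeasurableSpace G := borel G
    haveI : BorelSpace G := ⟨rfl⟩
    ∀ r : LatticeRep G, ∃ β₀ : ℝ, ∀ β β' : ℝ, β₀ ≤ β → β ≤ β' → ∀ L : ℕ, 8 ≤ L →
      coldDefect r.ρ β' L ≤ 1 / 2 ^ 24 → coldDefect r.ρ β L ≤ 1 / 2 ^ 24

/-- **CERT♭ — `CofinalCertificateSC` (the Yang–Mills content as COFINAL decidable instances; crux of the line).**  For compact simple
simply-connected `G` and every `r`: for every `β₁` there are a coupling `β ≥ β₁` and a lattice size `L ≥ 8` with the cold box certified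
deep-pure, `δᶜ_β(L) ≤ 2⁻²⁴` (the basin of the landed seam at the SHARP tree recursion constant `2²⁰`, `coldDefect_sq_le_two_pow`; rev 1 used `1/(16·squaringConst)`).  Each instance is ONE
inequality between two Haar integrals over finitely many link variables; no ruler, no width, no uniformity in β.  Weaker by name than
`ColdExitSC` (`cofinalCertificate_of_coldExit`) and than `FSSHandover.DeepCertificateSC`.  Why it might fail: false for `U(1)₄` (Coulomb: no deep-pure box at any size), open
for SU(2) beyond the strong-coupling window — it is «not massless» on a cofinal set of couplings, at depth; and no rigorous producer of a
single weak-coupling instance exists (box side ≳ 5ℓ½(β) ≈ 70–150 sites at β_W ∈ [2.3, 2.5]: the desk's «THE NUMBER»).  Sources: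
Guth1980 ∕ FrohlichSpencer1982 (U(1)₄), OsterwalderSeiler1978, census B7/B15, card finite-size-criterion-crossover (OneCertifiedCube). -/
def CofinalCertificateSC : Prop :=
  ∀ (G : Type) [Group G] [TopologicalSpace G] [IsTopologicalGroup G] [CompactSpace G],
    IsCompactSimpleLieGroup G → SimplyConnectedSpace G →
    letI : MeasurableSpace G := borel G
    haveI : BorelSpace G := ⟨rfl⟩
    ∀ r : LatticeRep G, ∀ β₁ : ℝ, ∃ β : ℝ, β₁ ≤ β ∧ ∃ L : ℕ, 8 ≤ L ∧
      coldDefect r.ρ β L ≤ 1 / 2 ^ 24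

/-! ## §2 Seams and comparisons, PROVED -/

section Basin

variable {G : Type} [Group G] [TopologicalSpace G] [IsTopologicalGroup G] [CompactSpace G]
  [MeasurableSpace G] [BorelSpace G]

/-- **Basin entry ⇒ cold pressure at the SHARP tree constant `C = 2²⁰`** (rev 2, crit-3 P3): `δᶜ_β(L) ≤ 2⁻²⁴` at some `L ≥ 8`,
`β ≥ 0`, gives `ColdPressureAt r.ρ β L` — the landed seam `coldPressureAt_of_exit_recursion` fed with the landed unconditional recursion
`AspectBootstrap.coldDefect_sq_le_two_pow` (`δᶜ_β(L') ≤ 2²⁰·δᶜ_β(L)²`, any compact `G`, `β ≥ 0`, `L ≥ 8`, `L' ∈ [2L, 4L]`). -/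
theorem coldPressureAt_of_le (r : LatticeRep G) {β : ℝ} (hβ : 0 ≤ β) {L : ℕ} (hL : 8 ≤ L)
    (h : coldDefect r.ρ β L ≤ 1 / 2 ^ 24) : ColdPressureAt r.ρ β L := by
  have hmax : max ((2 : ℝ) ^ 20) 2 = 2 ^ 20 := max_eq_left (by norm_num)
  refine coldPressureAt_of_exit_recursion r hβ (C := (2 : ℝ) ^ 20) (by positivity) (L₀ := 8)
    (fun L hL L' h₁ h₂ => coldDefect_sq_le_two_pow r hβ L hL L' h₁ h₂) (by rw [max_self]; exact hL) ?_
  rw [hmax]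
  have : (1 : ℝ) / (16 * 2 ^ 20) = 1 / 2 ^ 24 := by norm_num
  rw [this]
  exact h

end Basin

/-- **M ⇒ M_c** (the cold restriction is weaker by name). -/
theorem coldMonotone_of_purityMonotone (hM : PurityMonotoneSC) : ColdMonotoneSC := by
  intro G _ _ _ _ hG hsc
  letI : MeasurableSpace G := borel G
  haveI : BorelSpace G := ⟨rfl⟩
  intro r
  obtain ⟨β₀, hβ₀⟩ := hM G hG hsc r
  exact ⟨β₀, fun β β' h₁ h₂ L hL _ => hβ₀ β β' h₁ h₂ L hL⟩

/-- **M_c ⇒ M♭** (a `2⁻²⁴`-pure box is cold: `2⁻²⁴ ≤ 1/4`). -/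
theorem basinHeredity_of_coldMonotone (hM : ColdMonotoneSC) : BasinHereditySC := by
  intro G _ _ _ _ hG hsc
  letI : MeasurableSpace G := borel G
  haveI : BorelSpace G := ⟨rfl⟩
  intro r
  obtain ⟨β₀, hβ₀⟩ := hM G hG hsc r
  refine ⟨β₀, fun β β' h₁ h₂ L hL hδ => ?_⟩
  exact le_trans (hβ₀ β β' h₁ h₂ L hL (le_trans hδ (by norm_num))) hδ

/-- **M ⇒ M♭**. -/
theorem basinHeredity_of_purityMonotone (hM : PurityMonotoneSC) : BasinHereditySC :=
  basinHeredity_of_coldMonotone (coldMonotone_of_purityMonotone hM)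

/-- **THE SEAM (PROVED): M♭ ∧ CERT♭ ⇒ `ColdPressureOnsetSC`** — deep-purity certificates are inherited DOWN the coupling. -/
theorem coldPressureOnsetSC_of_ratchet (hM : BasinHereditySC) (hC : CofinalCertificateSC) : ColdPressureOnsetSC := by
  intro G _ _ _ _ hG hsc
  letI : MeasurableSpace G := borel G
  haveI : BorelSpace G := ⟨rfl⟩
  intro r
  obtain ⟨β₀, hβ₀⟩ := hM G hG hsc r
  refine ⟨max β₀ 0, fun β hβ => ?_⟩
  have hβ0 : 0 ≤ β := le_trans (le_max_right _ _) hβ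
  have hβ₀' : β₀ ≤ β := le_trans (le_max_left _ _) hβ
  obtain ⟨βs, hβs, L, hL, hcert⟩ := hC G hG hsc r β
  exact ⟨L, le_trans (by norm_num) hL, coldPressureAt_of_le r hβ0 hL (hβ₀ β βs hβ₀' hβs L hL hcert)⟩

/-- **M♭ ∧ CERT♭ ∧ X_cp ⇒ `IRsc`** (the simply-connected half). -/
theorem IRsc_of_ratchet (hM : BasinHereditySC) (hC : CofinalCertificateSC) (hX : AFToColdPressure) : IRsc :=
  IRsc_of_cp (coldPressureOnsetSC_of_ratchet hM hC) hX

/-- **The line concludes the crux `IR` BY NAME** from the four obligations (`ColdPressurePincer.IR_of_cp_repaired`).  No sorry. -/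
theorem IR_of : BasinHereditySC → CofinalCertificateSC → AFToColdPressure → IRnsc →
    Summit.QuantumFields.YangMills.Theses.BalabanLadder.IR :=
  fun hM hC hX hN => IR_of_cp_repaired (coldPressureOnsetSC_of_ratchet hM hC) hX hN

/-- The cold ratchet M_c also concludes. -/
theorem IR_of_coldMonotone : ColdMonotoneSC → CofinalCertificateSC → AFToColdPressure → IRnsc →
    Summit.QuantumFields.YangMills.Theses.BalabanLadder.IR :=
  fun hM => IR_of (basinHeredity_of_coldMonotone hM)

/-- The full ratchet M also concludes. -/
theorem IR_of_purityMonotone : PurityMonotoneSC → CofinalCertificateSC → AFToColdPressure → IRnsc →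
    Summit.QuantumFields.YangMills.Theses.BalabanLadder.IR :=
  fun hM => IR_of (basinHeredity_of_purityMonotone hM)

/-- **CERT♭ is weaker than the bridge's E by name**: `ColdExitSC → CofinalCertificateSC` (eventually ⇒ cofinally). -/
theorem cofinalCertificate_of_coldExit (hE : ColdExitSC) : CofinalCertificateSC := by
  intro G _ _ _ _ hG hsc
  letI : MeasurableSpace G := borel G
  haveI : BorelSpace G := ⟨rfl⟩
  intro r β₁
  obtain ⟨β₂, hβ₂⟩ := hE G hG hsc r (1 / 2 ^ 24) (by positivity)
  obtain ⟨L, hL, hδ⟩ := hβ₂ (max β₁ β₂) (le_max_right _ _) 8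
  exact ⟨max β₁ β₂, le_max_left _ _, L, hL, hδ⟩

/-! ## §2b Composability with BASIN WIDENING (idea-9's crux, cited by statement; sorry-free here)
If the abstract bootstrap's basin is widened from `2⁻²⁴` to an entry threshold `θ ≤ 1/4` (idea-9 `basin-transfer`: PROVED for
`θ = 2⁻¹⁹` as `BasinTransfer.abstractBasin_two_pow_19`; their crux is `θ = 1/16`), then certificates are needed only at depth `θ`
— for `θ = 1/16` a free-energy ratio at the 10⁻² level on a ≈ 2 fm box, MC-evidencable by the integral method (never a certificate) —
and the COLD ratchet M_c (which covers every threshold `≤ 1/4` at once) still hands them down.  Workfiles are not importable across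
lines on the farm, so idea-9's `AbstractBasin θ epsStar` is RESTATED here as `AbstractBasinFrom θ` (same shape, `epsStar = 2⁻²⁴`). -/

/-- Cofinal certificates at depth `θ`: `CofinalCertificateAt (1/2^24)` is `CofinalCertificateSC` (`cofinalCertificateAt_basin_iff`). -/
def CofinalCertificateAt (θ : ℝ) : Prop :=
  ∀ (G : Type) [Group G] [TopologicalSpace G] [IsTopologicalGroup G] [CompactSpace G],
    IsCompactSimpleLieGroup G → SimplyConnectedSpace G →
    letI : MeasurableSpace G := borel G
    haveI : BorelSpace G := ⟨rfl⟩
    ∀ r : LatticeRep G, ∀ β₁ : ℝ, ∃ β : ℝ, β₁ ≤ β ∧ ∃ L : ℕ, 8 ≤ L ∧ coldDefect r.ρ β L ≤ θ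

/-- The abstract basin from entry threshold `θ` to the seam depth `2⁻²⁴` (idea-9's `BasinTransfer.AbstractBasin θ epsStar`, restated):
for every axis-symmetric, trace-positive, volume-bounded family, a `θ`-pure box of side `≥ 8` yields a `2⁻²⁴`-pure box of side `≥ 8`. -/
def AbstractBasinFrom (θ : ℝ) : Prop :=
  ∀ Z : ℕ → ℕ → ℕ → ℕ → ℝ, IsAxisSymmetric Z → IsTracePositive Z → HasVolumeBounds Z →
    ∀ L : ℕ, 8 ≤ L → boxDefect Z L ≤ θ → ∃ L' : ℕ, 8 ≤ L' ∧ boxDefect Z L' ≤ 1 / 2 ^ 24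

theorem cofinalCertificateAt_basin_iff : CofinalCertificateAt (1 / 2 ^ 24) ↔ CofinalCertificateSC := Iff.rfl

/-- The trivial basin (entry at the seam depth itself). -/
theorem abstractBasinFrom_two_pow_24 : AbstractBasinFrom (1 / 2 ^ 24) :=
  fun _ _ _ _ L hL h => ⟨L, hL, h⟩

/-- **WIDE-BASIN SEAM (PROVED): M_c ∧ (abstract basin from θ ≤ 1/4) ∧ (cofinal certificates at depth θ) ⇒ `ColdPressureOnsetSC`.**
The certificate at `(β⋆, L)` is cold (`θ ≤ 1/4`), the cold ratchet hands `δᶜ_β(L) ≤ θ` down to `β`, the basin at `β` (Wilson family: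
`axisSymmetric`, `tracePositive`, `volumeBounds` at `β ≥ 0`) deepens it to `2⁻²⁴` at some `L' ≥ 8`, and `coldPressureAt_of_le` concludes. -/
theorem coldPressureOnsetSC_of_wideBasin {θ : ℝ} (hθ : θ ≤ 1 / 4) (hM : ColdMonotoneSC) (hB : AbstractBasinFrom θ)
    (hC : CofinalCertificateAt θ) : ColdPressureOnsetSC := by
  intro G _ _ _ _ hG hsc
  letI : MeasurableSpace G := borel G
  haveI : BorelSpace G := ⟨rfl⟩
  intro r
  obtain ⟨β₀, hβ₀⟩ := hM G hG hsc r
  refine ⟨max β₀ 0, fun β hβ => ?_⟩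
  have hβ0 : 0 ≤ β := le_trans (le_max_right _ _) hβ
  have hβ₀' : β₀ ≤ β := le_trans (le_max_left _ _) hβ
  obtain ⟨βs, hβs, L, hL, hcert⟩ := hC G hG hsc r β
  have hdown : coldDefect r.ρ β L ≤ θ :=
    le_trans (hβ₀ β βs hβ₀' hβs L hL (le_trans hcert hθ)) hcert
  have hbox : boxDefect (wilsonFinTorusPartition r.ρ β) L ≤ θ := by rw [← coldDefect_eq_boxDefect]; exact hdown
  obtain ⟨L', hL', hδ'⟩ := hB _ (axisSymmetric r β) (tracePositive r hβ0) (volumeBounds r hβ0) L hL hbox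
  have hδ'' : coldDefect r.ρ β L' ≤ 1 / 2 ^ 24 := by rw [coldDefect_eq_boxDefect]; exact hδ'
  exact ⟨L', le_trans (by norm_num) hL', coldPressureAt_of_le r hβ0 hL' hδ''⟩

/-- **Wide-basin edition of the line**: `M_c ∧ AbstractBasinFrom θ ∧ CofinalCertificateAt θ ∧ X ∧ N ⇒ IR` for any `θ ≤ 1/4`
(with `θ = 2⁻²⁴` and `abstractBasinFrom_two_pow_24` this is `IR_of_coldMonotone`; with idea-9's proved rung it holds at `θ = 2⁻¹⁹`;
with idea-9's crux at `θ = 1/16`). -/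
theorem IR_of_wideBasin {θ : ℝ} (hθ : θ ≤ 1 / 4) : ColdMonotoneSC → AbstractBasinFrom θ → CofinalCertificateAt θ →
    AFToColdPressure → IRnsc → Summit.QuantumFields.YangMills.Theses.BalabanLadder.IR :=
  fun hM hB hC hX hN => IR_of_cp_repaired (coldPressureOnsetSC_of_wideBasin hθ hM hB hC) hX hN

/-! ## §2d FLOOR-UNIT EDITION — X ELIMINATED (joint shortlist 03:36Z: «an E-line inherits X as a second load unless re-based to floor units»)
The ratchet hands a certificate DOWN the coupling at FIXED LATTICE size `L`; in the floor units `a(β)` of `LowerBounds G r a` the handed-down box at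
`β ≤ β⋆` has size `a(β)·L`.  If the cofinal certificates are DENSE IN FLOOR UNITS — above every large `β` there is a certified box `(β⋆, L)` with
`a(β)·L ≤ T` — then the handed-down cold pressure at `β` has length `ξ⋆(β) ≤ L ≤ T/a(β)`: exactly the PIN that `AFToColdPressure` (X) was imported
to supply.  So `M♭ ∧ CERTᴴ ⇒ IRsc` directly over the tree's rate seam `gapInUnits_of_coldPressure_pinned` — no X, no R-stub, no H-window.
Density in practice: consecutive certificates `β⋆_i < β⋆_{i+1}` with `a(β⋆_i)/a(β⋆_{i+1}) ≤ T/s_pure` (one certified ≈ s_pure-box per bounded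
scale factor) — the same instrument class as CERT♭ («THE NUMBER», cofinally), now carrying the floor-unit bookkeeping instead of X. -/

/-- **CERTᴴ — `PinnedCertificatesSC` (cofinal deep-purity certificates, dense in floor units; instrument class, never a prover target).**
Under the floor hypothesis `LowerBounds G r a` of `IR` itself: there are `T, β₁` such that above every `β ≥ β₁` some coupling `β⋆ ≥ β` carries a
certified `2⁻²⁴`-pure box of lattice size `L ≥ 8` with `a(β)·L ≤ T` (at most `T` floor-lengths AT `β`).  Conditional in the way `IR` is. -/
def PinnedCertificatesAt (θ : ℝ) : Prop :=
  ∀ (G : Type) [Group G] [TopologicalSpace G] [IsTopologicalGroup G] [CompactSpace G],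
    IsCompactSimpleLieGroup G → SimplyConnectedSpace G →
    letI : MeasurableSpace G := borel G
    haveI : BorelSpace G := ⟨rfl⟩
    ∀ (r : LatticeRep G) (a : ℝ → ℝ), (∀ β, 0 < a β) → Tendsto a atTop (𝓝 0) → LowerBounds G r a →
      ∃ T β₁ : ℝ, ∀ β : ℝ, β₁ ≤ β →
        ∃ βs : ℝ, β ≤ βs ∧ ∃ L : ℕ, 8 ≤ L ∧ a β * (L : ℝ) ≤ T ∧ coldDefect r.ρ βs L ≤ θ

/-- CERTᴴ at the seam depth `2⁻²⁴`. -/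
def PinnedCertificatesSC : Prop := PinnedCertificatesAt (1 / 2 ^ 24)

/-- **M♭₂ — `BasinHereditySlackSC` (rev 7: the REGISTERED form of the ratchet — heredity with a factor-2 slack).**  A `2⁻²⁵`-pure box at the
finer coupling is `2⁻²⁴`-pure at the coarser one.  Strictly weaker than M♭ (`basinHereditySlack_of_basinHeredity`); immune to
sub-dominant violations of level descent carrying less than half the defect (threshold heredity without slack is fragile exactly AT the
threshold); what it still forbids is a level carrying the bulk of the defect rising by a factor 2 between `β` and `β'`. -/
def BasinHereditySlackSC : Prop :=
  ∀ (G : Type) [Group G] [TopologicalSpace G] [IsTopologicalGroup G] [CompactSpace G],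
    IsCompactSimpleLieGroup G → SimplyConnectedSpace G →
    letI : MeasurableSpace G := borel G
    haveI : BorelSpace G := ⟨rfl⟩
    ∀ r : LatticeRep G, ∃ β₀ : ℝ, ∀ β β' : ℝ, β₀ ≤ β → β ≤ β' → ∀ L : ℕ, 8 ≤ L →
      coldDefect r.ρ β' L ≤ 1 / 2 ^ 25 → coldDefect r.ρ β L ≤ 1 / 2 ^ 24

theorem basinHereditySlack_of_basinHeredity (h : BasinHereditySC) : BasinHereditySlackSC := by
  intro G _ _ _ _ hG hsc
  letI : MeasurableSpace G := borel G
  haveI : BorelSpace G := ⟨rfl⟩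
  intro r
  obtain ⟨β₀, hβ₀⟩ := h G hG hsc r
  exact ⟨β₀, fun β β' hβ hββ' L hL hδ => hβ₀ β β' hβ hββ' L hL (le_trans hδ (by norm_num))⟩

/-- **GENERAL FLOOR-UNIT SEAM (PROVED)**: any heredity `θ'`-pure-at-`β'` ⇒ `2⁻²⁴`-pure-at-`β` plus certificates at depth `θ'`, dense in floor
units, give `IRsc`. -/
theorem irsc_of_heredity_pinned {θ : ℝ}
    (hM : ∀ (G : Type) [Group G] [TopologicalSpace G] [IsTopologicalGroup G] [CompactSpace G],
      IsCompactSimpleLieGroup G → SimplyConnectedSpace G →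
      letI : MeasurableSpace G := borel G
      haveI : BorelSpace G := ⟨rfl⟩
      ∀ r : LatticeRep G, ∃ β₀ : ℝ, ∀ β β' : ℝ, β₀ ≤ β → β ≤ β' → ∀ L : ℕ, 8 ≤ L →
        coldDefect r.ρ β' L ≤ θ → coldDefect r.ρ β L ≤ 1 / 2 ^ 24)
    (hC : PinnedCertificatesAt θ) : IRsc := by
  intro G _ _ _ _ hG hsc
  letI : MeasurableSpace G := borel G
  haveI : BorelSpace G := ⟨rfl⟩
  intro r a ha ha0 hlb
  obtain ⟨β₀, hβ₀⟩ := hM G hG hsc r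
  obtain ⟨T, β₁, hcert⟩ := hC G hG hsc r a ha ha0 hlb
  have key : ∀ β : ℝ, max (max β₀ 0) β₁ ≤ β → ∃ L : ℕ, 1 ≤ L ∧ a β * (L : ℝ) ≤ T ∧ ColdPressureAt r.ρ β L := by
    intro β hβ
    have hβ0' : β₀ ≤ β := le_trans ((le_max_left _ _).trans (le_max_left _ _)) hβ
    have hβ00 : (0 : ℝ) ≤ β := le_trans ((le_max_right _ _).trans (le_max_left _ _)) hβ
    have hβ1 : β₁ ≤ β := le_trans (le_max_right _ _) hβ
    obtain ⟨βs, hββs, L, hL, hpin, hδ⟩ := hcert β hβ1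
    have hdown : coldDefect r.ρ β L ≤ 1 / 2 ^ 24 := hβ₀ β βs hβ0' hββs L hL hδ
    exact ⟨L, le_trans (by norm_num) hL, hpin, coldPressureAt_of_le r hβ00 hL hdown⟩
  refine gapInUnits_of_coldPressure_pinned r a ha ha0 (β₂ := max (max β₀ 0) β₁) (fun β hβ => ?_) (T := T + 1)
    (β₆ := max (max β₀ 0) β₁) (fun β hβ => ?_)
  · obtain ⟨L, h1, -, h3⟩ := key β hβ
    exact ⟨L, h1, h3⟩
  · obtain ⟨L, h1, h2, h3⟩ := key β hβ
    have hle : (cpLength r.ρ β : ℝ) ≤ (L : ℝ) := by exact_mod_cast cpLength_le r.ρ β h1 h3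
    have hmul := mul_le_mul_of_nonneg_left hle (ha β).le
    linarith

/-- **FLOOR-UNIT SEAM (PROVED): M♭ ∧ CERTᴴ ⇒ `IRsc` — no AF pin, no recursion stub.**  For `β ≥ max (max β₀ 0) β₁` take the certificate
`(β⋆, L)` above `β`; heredity hands `δᶜ ≤ 2⁻²⁴` down to `(β, L)`; `coldPressureAt_of_le` (sharp R, landed) gives `ColdPressureAt r.ρ β L`, so
`ξ⋆(β) ≤ L` (`cpLength_le`) and `a β · ξ⋆(β) ≤ a β · L ≤ T < T + 1`; `gapInUnits_of_coldPressure_pinned` concludes. -/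
theorem irsc_of_pinnedRatchet (hM : BasinHereditySC) (hC : PinnedCertificatesSC) : IRsc :=
  irsc_of_heredity_pinned (θ := 1 / 2 ^ 24) hM hC

/-- **Slack edition (rev 7, OF RECORD): M♭₂ ∧ CERTᴴ(2⁻²⁵) ⇒ `IRsc`.** -/
theorem irsc_of_slackRatchet (hM : BasinHereditySlackSC) (hC : PinnedCertificatesAt (1 / 2 ^ 25)) : IRsc :=
  irsc_of_heredity_pinned (θ := 1 / 2 ^ 25) hM hC

/-- **`M♭₂ ∧ CERTᴴ(2⁻²⁵) ∧ N ⇒ IR` BY NAME (rev 7, the bill of record).** -/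
theorem IR_of_slackRatchet (hM : BasinHereditySlackSC) (hC : PinnedCertificatesAt (1 / 2 ^ 25)) (hN : IRnsc) :
    Summit.QuantumFields.YangMills.Theses.BalabanLadder.IR :=
  IR_of_cases (irsc_of_slackRatchet hM hC) hN

/-- **Floor-unit edition of the line: `M♭ ∧ CERTᴴ ∧ N ⇒ IR` BY NAME — two obligation Props + the residual, X gone.** -/
theorem IR_of_pinnedRatchet (hM : BasinHereditySC) (hC : PinnedCertificatesSC) (hN : IRnsc) :
    Summit.QuantumFields.YangMills.Theses.BalabanLadder.IR :=
  IR_of_cases (irsc_of_pinnedRatchet hM hC) hN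

/-! ## §2h (rev 12) THE CERTIFICATE WIDENED TO `1/24` BY THE TREE'S BASIN RUNGS (crit-3 P3 «re-base CERT on idea-9's widened basin»)

At FIXED `β ≥ 0` purity climbs in `L` for free: the landed rungs `basin_step24` (idea-9, p604479), `basin_step6` (p603750),
`basin_step8` (p603051), `basin_step9` (Rung, `defectSquaring_double_sharp`) applied to the Wilson family (`axisSymmetric`,
`tracePositive`, `volumeBounds`) take ONE `1/24`-pure cold box of side `L ≥ 8` to a `2⁻²⁵`-pure (indeed `< 2⁻³²`-pure) cold box of
side `2¹⁴·L` at the SAME `β` — fourteen exact doublings, scale factor explicit, so a certificate of BOUNDED PHYSICAL SIZE stays bounded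
(`T ↦ 2¹⁴·T`).  Hence `PinnedCertificatesAt (1/24) → PinnedCertificatesAt (1/2^25)` and the bill edition
`IR_of_slackRatchet24 : M♭₂ → CERT(1/24) → N → IR`: the decidable instances may be certified at the FEW-PERCENT level `δᶜ ≤ 1/24`
(sorry-free seam; the sign M♭₂ still does all the β-transport; nothing here is YM content). -/

section Widen

variable {G : Type} [Group G] [TopologicalSpace G] [IsTopologicalGroup G] [CompactSpace G] [MeasurableSpace G] [BorelSpace G]

/-- **Purity climbs in `L` at fixed `β ≥ 0`** — the landed `PurityClimb.coldDefect_widen_24` (p605701), by name: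
`δᶜ_β(L) ≤ 1/24`, `L ≥ 8` ⇒ `δᶜ_β(2¹⁴L) ≤ 2⁻²⁵`. -/
theorem coldDefect_widen_24 (r : LatticeRep G) {β : ℝ} (hβ : 0 ≤ β) (L : ℕ) (hL : 8 ≤ L)
    (h : coldDefect r.ρ β L ≤ 1 / 24) : coldDefect r.ρ β (16384 * L) ≤ 1 / 2 ^ 25 :=
  Summit.QuantumFields.YangMills.Cruxes.IR.PurityClimb.coldDefect_widen_24 r hβ L hL h

end Widen

/-- **CERT widens for free**: a pinned `1/24`-pure certificate of bounded physical size gives a pinned `2⁻²⁵`-pure one of bounded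
physical size (`T ↦ 2¹⁴ T`, same `βs`), by `coldDefect_widen_24`. -/
theorem pinnedCertificates_widen (hC : PinnedCertificatesAt (1 / 24)) : PinnedCertificatesAt (1 / 2 ^ 25) := by
  intro G _ _ _ _ hG hsc
  letI : MeasurableSpace G := borel G
  haveI : BorelSpace G := ⟨rfl⟩
  intro r a ha ha0 hlb
  obtain ⟨T, β₁, h⟩ := hC G hG hsc r a ha ha0 hlb
  refine ⟨16384 * T, max β₁ 0, fun β hβ => ?_⟩
  obtain ⟨βs, hβs, L, hL, haL, hd⟩ := h β ((le_max_left _ _).trans hβ)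
  have hβ0 : 0 ≤ βs := ((le_max_right _ _).trans hβ).trans hβs
  refine ⟨βs, hβs, 16384 * L, by omega, ?_, coldDefect_widen_24 r hβ0 L hL hd⟩
  have : a β * ((16384 * L : ℕ) : ℝ) = 16384 * (a β * (L : ℝ)) := by push_cast; ring
  rw [this]
  linarith

/-- **Bill edition with the FEW-PERCENT certificate**: `M♭₂ → CERT(1/24) → N → IR` (the instances are `δᶜ ≤ 1/24`-certificates at
bounded physical size, cofinal in `β`; the registered bill `IR_of_slackRatchet` is the case `2⁻²⁵`). -/
theorem IR_of_slackRatchet24 (hM : BasinHereditySlackSC) (hC : PinnedCertificatesAt (1 / 24)) (hN : IRnsc) :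
    Summit.QuantumFields.YangMills.Theses.BalabanLadder.IR :=
  IR_of_slackRatchet hM (pinnedCertificates_widen hC) hN

/-! ## §2c SPECTRAL LEMMA (finite-level model) — PROVED, sorry-free
Why LEVEL DESCENT ⇒ M_c.  Model one spatial box by a finite spectral datum: vacuum eigenvalue normalised to `1` and excited level
weights `μ_j = λ_j/λ₀ ∈ [0,1]` (the tree's `AspectBootstrap.HasSpectralDatum` is the summable version of this shape); at temporal extent `t`
the partition function is `z_t = 1 + Σ_j μ_j^t` and the purity defect is `pdef t μ = 1 − z_{2t}/z_t²` (= `boxDefect` with `t = L/4`).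
`LevelModel.pdef_le_of_levelDescent`: if `0 ≤ μ_j ≤ μ'_j ≤ 1` for all `j` (every level ratio at the smaller coupling is below the one at the
larger coupling = LEVEL DESCENT) and `μ'` is COLD (`pdef t μ' ≤ 1/4`), then `pdef t μ ≤ pdef t μ'` — the defect is handed down.  Proof: one
coordinate at a time (`LevelModel.step`); in rest-sum coordinates `(A, B, v)` the map `u ↦ (B+u²)/(A+u)²` is antitone on `[0, B/A]`
(`G_antitone`, an explicit factorisation), and coldness forces `A + v ≤ 4/3`, `v·A ≤ 2/9 < 1 ≤ B` (`core`).  The cold hypothesis is needed: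
`LevelModel.hot_counterexample` (two levels, `t = 1`: raising the dominant weight `0.98 ↦ 0.99` LOWERS the defect).  What is NOT typed: the
matching of the Wilson transfer-matrix spectra at two couplings (decreasing rearrangement) — level descent itself stays the informal content of
the registered stub M♭. -/

namespace LevelModel

open Finset


/-- Single-coordinate algebra: `u ↦ (B + u²)/(A + u)²` is antitone on `[0, B/A]`. -/
theorem G_antitone {A B u v : ℝ} (hA : 0 < A) (hB : 0 ≤ B) (hu : 0 ≤ u) (huv : u ≤ v) (hv : v * A ≤ B) :
    (B + v ^ 2) / (A + v) ^ 2 ≤ (B + u ^ 2) / (A + u) ^ 2 := by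
  have hv0 : 0 ≤ v := le_trans hu huv
  have hAu : 0 < (A + u) ^ 2 := by positivity
  have hAv : 0 < (A + v) ^ 2 := by positivity
  rw [div_le_div_iff₀ hAv hAu]
  -- (B+u²)(A+v)² − (B+v²)(A+u)² = (v−u)·[B(2A+u+v) − A²(u+v) − 2Auv] ≥ 0
  have huA : u * A ≤ B := le_trans (mul_le_mul_of_nonneg_right huv hA.le) hv
  have hbr : 0 ≤ B * (2 * A + u + v) - A ^ 2 * (u + v) - 2 * A * u * v := by
    nlinarith [mul_nonneg hA.le (sub_nonneg.mpr hv), mul_nonneg hA.le (sub_nonneg.mpr huA),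
      mul_nonneg hu (sub_nonneg.mpr hv), mul_nonneg hB (sub_nonneg.mpr huv), mul_nonneg hu hv0]
  have key : (B + u ^ 2) * (A + v) ^ 2 - (B + v ^ 2) * (A + u) ^ 2
      = (v - u) * (B * (2 * A + u + v) - A ^ 2 * (u + v) - 2 * A * u * v) := by ring
  nlinarith [mul_nonneg (sub_nonneg.mpr huv) hbr, key]

/-- Core step in `(A, B, v)` coordinates: lowering one level weight `v ↦ u` does not increase the defect of a cold configuration. -/
theorem core {A B v u : ℝ} (hA1 : 1 ≤ A) (hB1 : 1 ≤ B) (_hBA : B ≤ A) (hv0 : 0 ≤ v) (hv1 : v ≤ 1)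
    (hu0 : 0 ≤ u) (huv : u ≤ v) (hcold : 1 - (B + v ^ 2) / (A + v) ^ 2 ≤ 1 / 3) :
    1 - (B + u ^ 2) / (A + u) ^ 2 ≤ 1 - (B + v ^ 2) / (A + v) ^ 2 := by
  have hA : 0 < A := by linarith
  have hAv : 0 < (A + v) ^ 2 := by positivity
  -- cold ⇒ (2/3)(A+v)² ≤ B + v² ⇒ vA ≤ (2/3)A² + (4/3)Av − v²/3 ≤ B  (uses A ≥ 1 ≥ v ≥ 0)
  have h23 : 2 / 3 * (A + v) ^ 2 ≤ B + v ^ 2 := by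
    have : 2 / 3 ≤ (B + v ^ 2) / (A + v) ^ 2 := by linarith
    rwa [le_div_iff₀ hAv] at this
  have hv2 : v ^ 2 ≤ v := by nlinarith
  have hvA : v * A ≤ B := by nlinarith [mul_nonneg hv0 (by linarith : (0:ℝ) ≤ A - 1), mul_nonneg (by linarith : (0:ℝ) ≤ A - 1) (by linarith : (0:ℝ) ≤ A - 1)]
  have := G_antitone hA (by linarith) hu0 huv hvA
  linarith

variable {n : ℕ}

/-- `z_s(μ) = 1 + Σ_j μ_j^s` (the vacuum contributes the `1`). -/
noncomputable def zs (s : ℕ) (μ : Fin n → ℝ) : ℝ := 1 + ∑ j, μ j ^ s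

/-- The purity defect of the finite spectral datum at temporal extent `t`: `1 − z_{2t}/z_t²`. -/
noncomputable def pdef (t : ℕ) (μ : Fin n → ℝ) : ℝ := 1 - zs (2 * t) μ / zs t μ ^ 2

theorem sum_sq_le_sq_sum (a : Fin n → ℝ) (ha : ∀ j, 0 ≤ a j) : ∑ j, a j ^ 2 ≤ (∑ j, a j) ^ 2 := by
  have hS : 0 ≤ ∑ j, a j := Finset.sum_nonneg fun j _ => ha j
  calc ∑ j, a j ^ 2 ≤ ∑ j, a j * ∑ i, a i := by
        apply Finset.sum_le_sum
        intro j _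
        rw [sq]
        exact mul_le_mul_of_nonneg_left (Finset.single_le_sum (fun i _ => ha i) (Finset.mem_univ j)) (ha j)
    _ = (∑ j, a j) ^ 2 := by rw [← Finset.sum_mul, sq]

/-- ONE-COORDINATE STEP.  `ν₂` is `ν₁` with coordinate `k` lowered; `ν₁` is a cold configuration in `[0,1]^n`. -/
theorem step {t : ℕ} (ν₁ ν₂ : Fin n → ℝ) (k : Fin n)
    (hagree : ∀ j, j ≠ k → ν₂ j = ν₁ j) (h0 : ∀ j, 0 ≤ ν₁ j) (h1 : ∀ j, ν₁ j ≤ 1)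
    (hk0 : 0 ≤ ν₂ k) (hk : ν₂ k ≤ ν₁ k) (hcold : pdef t ν₁ ≤ 1 / 3) :
    pdef t ν₂ ≤ pdef t ν₁ := by
  -- rest sums
  set A := 1 + ∑ j ∈ univ.erase k, ν₁ j ^ t with hAdef
  set B := 1 + ∑ j ∈ univ.erase k, ν₁ j ^ (2 * t) with hBdef
  set v := ν₁ k ^ t with hvdef
  set u := ν₂ k ^ t with hudef
  have hmem : k ∈ (univ : Finset (Fin n)) := mem_univ k
  have hz1t : zs t ν₁ = A + v := by
    unfold zs; rw [← Finset.add_sum_erase _ _ hmem]; ring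
  have hz1tt : zs (2 * t) ν₁ = B + v ^ 2 := by
    unfold zs; rw [← Finset.add_sum_erase _ _ hmem, hvdef, ← pow_mul' ]; ring
  have hrest_t : ∑ j ∈ univ.erase k, ν₂ j ^ t = ∑ j ∈ univ.erase k, ν₁ j ^ t :=
    Finset.sum_congr rfl fun j hj => by rw [hagree j (Finset.ne_of_mem_erase hj)]
  have hrest_tt : ∑ j ∈ univ.erase k, ν₂ j ^ (2 * t) = ∑ j ∈ univ.erase k, ν₁ j ^ (2 * t) :=
    Finset.sum_congr rfl fun j hj => by rw [hagree j (Finset.ne_of_mem_erase hj)]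
  have hz2t : zs t ν₂ = A + u := by
    unfold zs; rw [← Finset.add_sum_erase _ _ hmem, hrest_t]; ring
  have hz2tt : zs (2 * t) ν₂ = B + u ^ 2 := by
    unfold zs; rw [← Finset.add_sum_erase _ _ hmem, hrest_tt, hudef, ← pow_mul']; ring
  -- hypotheses of `core`
  have hpt : ∀ j, 0 ≤ ν₁ j ^ t := fun j => pow_nonneg (h0 j) t
  have hA1 : 1 ≤ A := by
    have : 0 ≤ ∑ j ∈ univ.erase k, ν₁ j ^ t := Finset.sum_nonneg fun j _ => hpt j
    linarith
  have hB1 : 1 ≤ B := by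
    have : 0 ≤ ∑ j ∈ univ.erase k, ν₁ j ^ (2 * t) := Finset.sum_nonneg fun j _ => pow_nonneg (h0 j) _
    linarith
  have hBA : B ≤ A := by
    have : ∑ j ∈ univ.erase k, ν₁ j ^ (2 * t) ≤ ∑ j ∈ univ.erase k, ν₁ j ^ t :=
      Finset.sum_le_sum fun j _ => pow_le_pow_of_le_one (h0 j) (h1 j) (by omega)
    linarith
  have hv0 : 0 ≤ v := hpt k
  have hv1 : v ≤ 1 := pow_le_one₀ (h0 k) (h1 k)
  have hu0 : 0 ≤ u := pow_nonneg hk0 t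
  have huv : u ≤ v := pow_le_pow_left₀ hk0 hk t
  unfold pdef
  rw [hz1t, hz1tt, hz2t, hz2tt]
  unfold pdef at hcold
  rw [hz1t, hz1tt] at hcold
  exact core hA1 hB1 hBA hv0 hv1 hu0 huv hcold

/-- The chain from `μ'` (m = 0) to `μ` (m = n): first `m` coordinates lowered. -/
def chain (μ μ' : Fin n → ℝ) (m : ℕ) : Fin n → ℝ := fun j => if (j : ℕ) < m then μ j else μ' j

theorem chain_zero (μ μ' : Fin n → ℝ) : chain μ μ' 0 = μ' := by
  funext j; simp [chain]

theorem chain_n (μ μ' : Fin n → ℝ) : chain μ μ' n = μ := by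
  funext j; simp [chain, j.isLt]

/-- **SPECTRAL LEMMA (finite-level model).**  If `0 ≤ μ_j ≤ μ'_j ≤ 1` for every level (LEVEL DESCENT from the coupling of `μ` to
that of `μ'`) and the configuration `μ'` is cold (`pdef t μ' ≤ 1/3`; rev 9: threshold relaxed from `1/4`), then `pdef t μ ≤ pdef t μ'`. -/
theorem pdef_le_of_levelDescent {t : ℕ} (μ μ' : Fin n → ℝ) (h0 : ∀ j, 0 ≤ μ j) (hle : ∀ j, μ j ≤ μ' j)
    (h1 : ∀ j, μ' j ≤ 1) (hcold : pdef t μ' ≤ 1 / 3) : pdef t μ ≤ pdef t μ' := by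
  -- induction along the chain
  have key : ∀ m : ℕ, m ≤ n → pdef t (chain μ μ' m) ≤ pdef t μ' := by
    intro m
    induction m with
    | zero => intro _; rw [chain_zero]
    | succ m ih =>
      intro hm
      have hm' : m < n := by omega
      have ihm := ih (by omega)
      -- chain (m+1) is chain m with coordinate ⟨m, hm'⟩ lowered from μ' m to μ m
      have hstep := step (t := t) (chain μ μ' m) (chain μ μ' (m + 1)) ⟨m, hm'⟩
        (by
          intro j hj
          have hjm : (j : ℕ) ≠ m := fun h => hj (Fin.ext h)
          simp only [chain]
          by_cases hj1 : (j : ℕ) < m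
          · simp [hj1, show (j : ℕ) < m + 1 by omega]
          · simp [hj1, show ¬ ((j : ℕ) < m + 1) by omega])
        (by intro j; simp only [chain]; split <;> [exact h0 j; exact le_trans (h0 j) (hle j)])
        (by intro j; simp only [chain]; split <;> [exact le_trans (hle j) (h1 j); exact h1 j])
        (by simp [chain, h0])
        (by simp [chain, hle])
        (le_trans ihm hcold)
      exact le_trans hstep ihm
  have := key n le_rfl
  rwa [chain_n] at this


/-- The cold hypothesis is necessary: a HOT two-level configuration where raising the dominant weight lowers the defect. -/
theorem hot_counterexample : pdef 1 ![(99 : ℝ) / 100, 1 / 2] < pdef 1 ![(98 : ℝ) / 100, 1 / 2] := by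
  unfold pdef zs
  simp [Fin.sum_univ_two]
  norm_num

/-- **Rearrangement step (rev 8).**  `pdef` is a symmetric function of the levels, so LEVEL DESCENT may be tested after ANY re-indexing
of the finer configuration — in particular after sorting both spectra decreasingly and comparing the `k`-th largest weights (crossing levels
are harmless): if `μ_j ≤ μ'_{σ j}` for some permutation `σ`, the cold defect is still handed down. -/
theorem pdef_le_of_levelDescent_perm {t : ℕ} (μ μ' : Fin n → ℝ) (σ : Equiv.Perm (Fin n)) (h0 : ∀ j, 0 ≤ μ j)
    (hle : ∀ j, μ j ≤ μ' (σ j)) (h1 : ∀ j, μ' j ≤ 1) (hcold : pdef t μ' ≤ 1 / 3) : pdef t μ ≤ pdef t μ' := by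
  have hzs : ∀ s : ℕ, zs s (μ' ∘ σ) = zs s μ' := by
    intro s
    unfold zs
    congr 1
    exact Equiv.sum_comp σ (fun j => μ' j ^ s)
  have hp : pdef t (μ' ∘ σ) = pdef t μ' := by unfold pdef; rw [hzs, hzs]
  have h := pdef_le_of_levelDescent (t := t) μ (μ' ∘ σ) h0 (fun j => hle j) (fun j => h1 (σ j)) (by rw [hp]; exact hcold)
  rwa [hp] at h

/-! ### Summable and soft versions — LANDED (rev 11): cited BY NAME from `Theorems/BalabanLadderIRLevelDescentLemma.lean` (p605032)

`Summit.QuantumFields.YangMills.Cruxes.IR.LevelDescent.defect_le_of_levelDescent_hasSum` (arbitrary index type, truncation + limit),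
`….tail_algebra`, `….defect_le_of_softLevelDescent_hasSum` (soft set + hard tail `τ` ⇒ `+ 2τ`), `….oneBoxDefect_le_of_levelDescent`,
`….oneBoxDefect_le_of_softLevelDescent`, `….coldDefect_le_of_levelDescent`, `….coldDefect_slack_of_softLevelDescent`, `….hot_counterexample`. -/

/-! ### Bridge to the tree's one-box trace sequences (rev 9) -/

/-- **Matched spectral data with LEVEL DESCENT** for two one-box trace sequences `z` (the COARSER coupling) and `z'` (the FINER one):
`HasSpectralDatum`-type data for both on a COMMON index type with a common vacuum index `i₀`, and the normalised weights ordered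
`λ_i/λ_{i₀} ≤ λ'_i/λ'_{i₀}` — every lattice-unit torus gap at the coarser coupling is at least the matched gap at the finer one. -/
def LevelDescentData (z z' : ℕ → ℝ) : Prop :=
  ∃ (ι : Type) (lam lam' : ι → ℝ) (i₀ : ι),
    (∀ i, 0 ≤ lam i ∧ lam i ≤ lam i₀) ∧ 0 < lam i₀ ∧ (∀ m : ℕ, HasSum (fun i => lam i ^ (m + 2)) (z (m + 2))) ∧
    (∀ i, 0 ≤ lam' i ∧ lam' i ≤ lam' i₀) ∧ 0 < lam' i₀ ∧ (∀ m : ℕ, HasSum (fun i => lam' i ^ (m + 2)) (z' (m + 2))) ∧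
    ∀ i, lam i / lam i₀ ≤ lam' i / lam' i₀

/-- Level descent + a cold finer box ⇒ the one-box defect `1 − z(2t)/z(t)²` is handed down to the coarser coupling (`t ≥ 2`) — the landed
`LevelDescent.oneBoxDefect_le_of_levelDescent`, by name. -/
theorem oneBoxDefect_le_of_levelDescentData {z z' : ℕ → ℝ} (h : LevelDescentData z z') {t : ℕ} (ht : 2 ≤ t)
    (hcold : 1 - z' (2 * t) / z' t ^ 2 ≤ 1 / 4) : 1 - z (2 * t) / z t ^ 2 ≤ 1 - z' (2 * t) / z' t ^ 2 :=
  Summit.QuantumFields.YangMills.Cruxes.IR.LevelDescent.oneBoxDefect_le_of_levelDescent h ht hcold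

/-- **SOFT matched data (rev 10; idea-2 O7.3 «soft-level descent + volume-law tail»).**  Descent `λ_i/λ₀ ≤ λ'_i/λ'₀` is assumed only on a set
`S ∋ i₀` of SOFT levels; the HARD levels of the COARSER sequence have total normalised `t`-weight `≤ τ` (`Sᶜ.indicator`, summed). -/
def SoftLevelDescentData (τ : ℝ) (t : ℕ) (z z' : ℕ → ℝ) : Prop :=
  ∃ (ι : Type) (lam lam' : ι → ℝ) (i₀ : ι) (S : Set ι) (τ' : ℝ),
    (∀ i, 0 ≤ lam i ∧ lam i ≤ lam i₀) ∧ 0 < lam i₀ ∧ (∀ m : ℕ, HasSum (fun i => lam i ^ (m + 2)) (z (m + 2))) ∧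
    (∀ i, 0 ≤ lam' i ∧ lam' i ≤ lam' i₀) ∧ 0 < lam' i₀ ∧ (∀ m : ℕ, HasSum (fun i => lam' i ^ (m + 2)) (z' (m + 2))) ∧
    i₀ ∈ S ∧ (∀ i ∈ S, lam i / lam i₀ ≤ lam' i / lam' i₀) ∧
    HasSum (Sᶜ.indicator fun i => (lam i / lam i₀) ^ t) τ' ∧ τ' ≤ τ

/-- Soft level descent + tail `τ` + a cold finer box ⇒ the one-box defect is handed down up to `2τ` (`t ≥ 2`) — the landed
`LevelDescent.oneBoxDefect_le_of_softLevelDescent`, by name. -/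
theorem oneBoxDefect_le_of_softLevelDescentData {τ : ℝ} {t : ℕ} {z z' : ℕ → ℝ} (h : SoftLevelDescentData τ t z z') (ht : 2 ≤ t)
    (hcold : 1 - z' (2 * t) / z' t ^ 2 ≤ 1 / 4) : 1 - z (2 * t) / z t ^ 2 ≤ (1 - z' (2 * t) / z' t ^ 2) + 2 * τ :=
  Summit.QuantumFields.YangMills.Cruxes.IR.LevelDescent.oneBoxDefect_le_of_softLevelDescent h ht hcold

end LevelModel

/-! ## §2e (rev 8) CERTᴴ ≤ H IN THE KERNEL: the floor handshake `FloorToPuritySC` (line 13's H) implies `PinnedCertificatesAt θ` for every `θ > 0`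

(crit-3 03:47:33Z №13(i) «weaker than H given LowerBounds-floors, modulo the floor-shape plumbing — not kernel-checked»: checked here.  The
plumbing is the first half of `ColdPurityBridge.irsc_of_handshake`: unpack `LowerBounds(i)` at `s := a β ≤ s₀`, feed H, read off `a β · L′ ≤ k`;
the cofinal witness is `βs := β` itself.)  Consequently the slack ratchet's bill is implied by {M♭₂, H, N} (`IR_of_slackRatchet_of_H`), i.e. on the
certificate side this line asks for LESS than the floor handshake; what it asks MORE is the sign M♭₂. -/

theorem pinnedCertificates_of_floorToPurity {θ : ℝ} (hθ : 0 < θ) (hH : FloorToPuritySC) : PinnedCertificatesAt θ := by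
  intro G _ _ _ _ hG hsc
  letI : MeasurableSpace G := borel G
  haveI : BorelSpace G := ⟨rfl⟩
  intro r a ha ha0 hlb
  obtain ⟨⟨v, ε, β₅, Λ₅, hv, hε, hfloor⟩, -⟩ := hlb
  obtain ⟨βH, s₀, k, hs₀, hHβ⟩ := hH G hG hsc r v hv ε Λ₅ θ hε hθ
  obtain ⟨βa, hβa⟩ : ∃ βa : ℝ, ∀ β : ℝ, βa ≤ β → a β ≤ s₀ := by
    have hev : ∀ᶠ β in atTop, a β < s₀ := ha0.eventually (gt_mem_nhds hs₀)
    obtain ⟨βa, h⟩ := Filter.eventually_atTop.1 hev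
    exact ⟨βa, fun β hβ => (h β hβ).le⟩
  refine ⟨k, max β₅ (max βH βa), fun β hβ => ?_⟩
  have hβ5 : β₅ ≤ β := le_trans (le_max_left _ _) hβ
  have hβH : βH ≤ β := le_trans ((le_max_left _ _).trans (le_max_right _ _)) hβ
  have hβa' : βa ≤ β := le_trans ((le_max_right _ _).trans (le_max_right _ _)) hβ
  obtain ⟨L', h8, -, h2, h3⟩ := hHβ β hβH (a β) (ha β) (hβa β hβa') (fun L hL => hfloor β hβ5 L hL)
  have hk : a β * (L' : ℝ) ≤ k := by
    have h := (le_div_iff₀ (ha β)).1 h2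
    simpa [mul_comm] using h
  exact ⟨β, le_rfl, L', h8, hk, h3⟩

/-- The slack ratchet's certificate side is implied by H: {M♭₂, H, N} ⇒ `IR` through `IR_of_slackRatchet`. -/
theorem IR_of_slackRatchet_of_H (hM : BasinHereditySlackSC) (hH : FloorToPuritySC) (hN : IRnsc) :
    Summit.QuantumFields.YangMills.Theses.BalabanLadder.IR :=
  IR_of_slackRatchet hM (pinnedCertificates_of_floorToPurity (by norm_num) hH) hN

/-! ## §2f (rev 9) THE MECHANISM, TYPED OVER TREE OBJECTS: `LevelDescentSC → ColdMonotoneSC → BasinHereditySC → BasinHereditySlackSC`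

`LevelDescentSC` says: beyond `β₀`, for `β ≤ β′` and every cubic box `L ≥ 8`, the Wilson one-box trace sequences at `β` (coarser) and `β′`
(finer) admit MATCHED spectral data with level descent (`LevelModel.LevelDescentData`).  By the summable spectral lemma this implies
`ColdMonotoneSC` (M_c), hence M♭ and the registered M♭₂ — so the informal «located mechanism» of the card (lattice-unit torus gaps
non-increasing in β after decreasing rearrangement, idea-2 O6) is now a typed Prop over the tree's own `wilsonFinTorusPartition` with a
kernel-checked implication down to the registered stub.  (It is STRONGER than M♭₂ and is NOT registered; M♭₂ stays the obligation.) -/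

/-- **LEVEL DESCENT (typed).**  Matched one-box spectral data with ordered normalised weights, coarser ≤ finer, in cold-or-not cubic boxes
`L ≥ 8`, for `β₀ ≤ β ≤ β′`. -/
def LevelDescentSC : Prop :=
  ∀ (G : Type) [Group G] [TopologicalSpace G] [IsTopologicalGroup G] [CompactSpace G],
    IsCompactSimpleLieGroup G → SimplyConnectedSpace G →
    letI : MeasurableSpace G := borel G
    haveI : BorelSpace G := ⟨rfl⟩
    ∀ r : LatticeRep G, ∃ β₀ : ℝ, ∀ β β' : ℝ, β₀ ≤ β → β ≤ β' → ∀ L : ℕ, 8 ≤ L →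
      LevelModel.LevelDescentData (wilsonFinTorusPartition r.ρ β L L L) (wilsonFinTorusPartition r.ρ β' L L L)

/-- Level descent ⇒ M_c (summable spectral lemma `LevelModel.oneBoxDefect_le_of_levelDescentData`, `t = L/4 ≥ 2`). -/
theorem coldMonotone_of_levelDescent (h : LevelDescentSC) : ColdMonotoneSC := by
  intro G _ _ _ _ hG hsc
  letI : MeasurableSpace G := borel G
  haveI : BorelSpace G := ⟨rfl⟩
  intro r
  obtain ⟨β₀, hβ⟩ := h G hG hsc r
  refine ⟨β₀, fun β β' h₀ h' L hL hcold => ?_⟩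
  have ht : 2 ≤ L / 4 := by omega
  exact LevelModel.oneBoxDefect_le_of_levelDescentData (hβ β β' h₀ h' L hL) ht hcold

/-- Level descent ⇒ the registered stub M♭₂. -/
theorem basinHereditySlack_of_levelDescent (h : LevelDescentSC) : BasinHereditySlackSC :=
  basinHereditySlack_of_basinHeredity (basinHeredity_of_coldMonotone (coldMonotone_of_levelDescent h))

/-- {LEVEL DESCENT, CERTᴴ(2⁻²⁵), N} ⇒ `IR` (the mechanism edition of the bill; the registered edition is `IR_of_stubs`). -/
theorem IR_of_levelDescent (h : LevelDescentSC) (hC : PinnedCertificatesAt (1 / 2 ^ 25)) (hN : IRnsc) :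
    Summit.QuantumFields.YangMills.Theses.BalabanLadder.IR :=
  IR_of_slackRatchet (basinHereditySlack_of_levelDescent h) hC hN

/-! ## §2g (rev 10) WHAT THE SLACK MEANS, IN THE KERNEL: `SoftLevelDescentSC (1/2^26) → BasinHereditySlackSC`

(idea-2 O7.3.)  M♭₂ needs descent only for the SOFT levels; the HARD levels of the coarser box (cutoff-scale states, O(g²) self-energies of
uncontrolled sign) may do anything provided their total normalised `t = L/4`-weight is `≤ 2⁻²⁶` — a volume-law tail.  The factor-2 slack
`2⁻²⁵ ⇒ 2⁻²⁴` of the registered stub is then EXACTLY consumed: `2⁻²⁵ + 2·2⁻²⁶ = 2⁻²⁴`. -/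

/-- **SOFT LEVEL DESCENT with tail `τ` (typed over the tree's partition functions).** -/
def SoftLevelDescentSC (τ : ℝ) : Prop :=
  ∀ (G : Type) [Group G] [TopologicalSpace G] [IsTopologicalGroup G] [CompactSpace G],
    IsCompactSimpleLieGroup G → SimplyConnectedSpace G →
    letI : MeasurableSpace G := borel G
    haveI : BorelSpace G := ⟨rfl⟩
    ∀ r : LatticeRep G, ∃ β₀ : ℝ, ∀ β β' : ℝ, β₀ ≤ β → β ≤ β' → ∀ L : ℕ, 8 ≤ L →
      LevelModel.SoftLevelDescentData τ (L / 4) (wilsonFinTorusPartition r.ρ β L L L) (wilsonFinTorusPartition r.ρ β' L L L)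

/-- Soft level descent with a `2⁻²⁶` tail ⇒ the registered stub M♭₂ (the slack is exactly consumed). -/
theorem basinHereditySlack_of_softLevelDescent (h : SoftLevelDescentSC (1 / 2 ^ 26)) : BasinHereditySlackSC := by
  intro G _ _ _ _ hG hsc
  letI : MeasurableSpace G := borel G
  haveI : BorelSpace G := ⟨rfl⟩
  intro r
  obtain ⟨β₀, hβ⟩ := h G hG hsc r
  refine ⟨β₀, fun β β' h₀ h' L hL hcold => ?_⟩
  have ht : 2 ≤ L / 4 := by omega
  have hcold4 : coldDefect r.ρ β' L ≤ 1 / 4 := hcold.trans (by norm_num)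
  have := LevelModel.oneBoxDefect_le_of_softLevelDescentData (hβ β β' h₀ h' L hL) ht hcold4
  have h24 : coldDefect r.ρ β' L + 2 * (1 / 2 ^ 26) ≤ (1 : ℝ) / 2 ^ 24 := by
    have : (1 : ℝ) / 2 ^ 25 + 2 * (1 / 2 ^ 26) = 1 / 2 ^ 24 := by norm_num
    linarith
  exact this.trans h24

/-- {SOFT LEVEL DESCENT (2⁻²⁶ tail), CERTᴴ(2⁻²⁵), N} ⇒ `IR`. -/
theorem IR_of_softLevelDescent (h : SoftLevelDescentSC (1 / 2 ^ 26)) (hC : PinnedCertificatesAt (1 / 2 ^ 25)) (hN : IRnsc) :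
    Summit.QuantumFields.YangMills.Theses.BalabanLadder.IR :=
  IR_of_slackRatchet (basinHereditySlack_of_softLevelDescent h) hC hN

/-! ## §2j (rev 13) THE FEW-PERCENT SIGN EDITION: `M₂₄ ∧ CERT(1/48) ∧ N ⇒ IR` — the sign, too, posed where it is MEASURABLE

With purity climbing in `L` for free at fixed `β` (§2h, `PurityClimb24`), the heredity sign need not be posed at depth `2⁻²⁵ → 2⁻²⁴`: the
FEW-PERCENT heredity `M₂₄` («a `1/48`-pure cold box at the finer coupling is `1/24`-pure at the coarser one, same lattice size `L ≥ 8`,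
eventually in `β`») hands a pinned `1/48`-certificate down to `β`, and the climb then reaches `2⁻²⁵` at `2¹⁴·L` — still bounded physical size.
`M₂₄` is the SAME physical sign as `M♭₂` (coarser coupling = bigger physical box = purer), logically independent of it as typed, implied like it
by level descent (`basinHeredity24_of_levelDescent`, soft tail `1/96`: `basinHeredity24_of_softLevelDescent`), and — the point — its instances and
its violations live at the PERCENT level of `δᶜ = 1 − Z(2t)/Z(t)²` on `8³…16³` cold boxes, where `ln Z(2t) − 2 ln Z(t)` is measurable by the
integral method (`∫ (⟨S⟩_{2t} − 2⟨S⟩_t) dβ'`): the B2 row tests the SIGN ITSELF, not a proxy.  Still summit-strength (it is the β-transport);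
still no YM content in the seam. -/

/-- **M₂₄ — FEW-PERCENT BASIN HEREDITY (the sign at measurable depth).**  Eventually in `β`: for `β ≤ β'` and every cold box `L ≥ 8`,
`δᶜ_{β'}(L) ≤ 1/48 ⇒ δᶜ_β(L) ≤ 1/24`.  Why it might fail: as for M♭₂ (a sub-dominant level of the coarser box overtaking under the factor-2
slack; bulk/roughening crossovers below `β₀`); at `U(1)₄`/`π₁ ≠ 1` the premise is never met in big boxes (vacuous, not false) — the content is
carried jointly with CERT.  Sources: as M♭₂ (Lüscher 1983 femto-universe; van Baal–Koller 1987; Berg–Billoire 1989 torelon/glueball finite-size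
spectra; Boyd et al. 1996 integral method). -/
def BasinHeredity24SC : Prop :=
  ∀ (G : Type) [Group G] [TopologicalSpace G] [IsTopologicalGroup G] [CompactSpace G],
    IsCompactSimpleLieGroup G → SimplyConnectedSpace G →
    letI : MeasurableSpace G := borel G
    haveI : BorelSpace G := ⟨rfl⟩
    ∀ r : LatticeRep G, ∃ β₀ : ℝ, ∀ β β' : ℝ, β₀ ≤ β → β ≤ β' → ∀ L : ℕ, 8 ≤ L →
      coldDefect r.ρ β' L ≤ 1 / 48 → coldDefect r.ρ β L ≤ 1 / 24

/-- M_c ⇒ M₂₄ (cold monotonicity at any thresholds below `1/4`). -/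
theorem basinHeredity24_of_coldMonotone (hM : ColdMonotoneSC) : BasinHeredity24SC := by
  intro G _ _ _ _ hG hsc
  letI : MeasurableSpace G := borel G
  haveI : BorelSpace G := ⟨rfl⟩
  intro r
  obtain ⟨β₀, hβ₀⟩ := hM G hG hsc r
  refine ⟨β₀, fun β β' h₁ h₂ L hL hδ => ?_⟩
  exact (hβ₀ β β' h₁ h₂ L hL (hδ.trans (by norm_num))).trans (hδ.trans (by norm_num))

/-- LEVEL DESCENT ⇒ M₂₄. -/
theorem basinHeredity24_of_levelDescent (h : LevelDescentSC) : BasinHeredity24SC :=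
  basinHeredity24_of_coldMonotone (coldMonotone_of_levelDescent h)

/-- SOFT LEVEL DESCENT with a `1/96` hard tail ⇒ M₂₄ (`1/48 + 2/96 = 1/24`). -/
theorem basinHeredity24_of_softLevelDescent (h : SoftLevelDescentSC (1 / 96)) : BasinHeredity24SC := by
  intro G _ _ _ _ hG hsc
  letI : MeasurableSpace G := borel G
  haveI : BorelSpace G := ⟨rfl⟩
  intro r
  obtain ⟨β₀, hβ⟩ := h G hG hsc r
  refine ⟨β₀, fun β β' h₀ h' L hL hcold => ?_⟩
  have ht : 2 ≤ L / 4 := by omega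
  have hcold4 : coldDefect r.ρ β' L ≤ 1 / 4 := hcold.trans (by norm_num)
  have := LevelModel.oneBoxDefect_le_of_softLevelDescentData (hβ β β' h₀ h' L hL) ht hcold4
  have h24 : coldDefect r.ρ β' L + 2 * (1 / 96) ≤ (1 : ℝ) / 24 := by
    have : (1 : ℝ) / 48 + 2 * (1 / 96) = 1 / 24 := by norm_num
    linarith
  exact this.trans h24

/-- **FEW-PERCENT SEAM (PROVED): M₂₄ ∧ CERT(1/48) ⇒ `IRsc`.**  For large `β` take the pinned `1/48`-certificate `(βs, L)` above `β`; M₂₄ hands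
`δᶜ ≤ 1/24` down to `(β, L)`; the climb (`coldDefect_widen_24`, tree rungs) gives `δᶜ_β(2¹⁴L) ≤ 2⁻²⁵ ≤ 2⁻²⁴` at physical size `≤ 2¹⁴·T`;
`coldPressureAt_of_le` + `cpLength_le` + `gapInUnits_of_coldPressure_pinned` conclude as in `irsc_of_heredity_pinned`. -/
theorem irsc_of_ratchet24 (hM : BasinHeredity24SC) (hC : PinnedCertificatesAt (1 / 48)) : IRsc := by
  intro G _ _ _ _ hG hsc
  letI : MeasurableSpace G := borel G
  haveI : BorelSpace G := ⟨rfl⟩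
  intro r a ha ha0 hlb
  obtain ⟨β₀, hβ₀⟩ := hM G hG hsc r
  obtain ⟨T, β₁, hcert⟩ := hC G hG hsc r a ha ha0 hlb
  have key : ∀ β : ℝ, max (max β₀ 0) β₁ ≤ β →
      ∃ L : ℕ, 1 ≤ L ∧ a β * (L : ℝ) ≤ 16384 * T ∧ ColdPressureAt r.ρ β L := by
    intro β hβ
    have hβ0' : β₀ ≤ β := le_trans ((le_max_left _ _).trans (le_max_left _ _)) hβ
    have hβ00 : (0 : ℝ) ≤ β := le_trans ((le_max_right _ _).trans (le_max_left _ _)) hβ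
    have hβ1 : β₁ ≤ β := le_trans (le_max_right _ _) hβ
    obtain ⟨βs, hββs, L, hL, hpin, hδ⟩ := hcert β hβ1
    have hdown : coldDefect r.ρ β L ≤ 1 / 24 := hβ₀ β βs hβ0' hββs L hL hδ
    have hclimb : coldDefect r.ρ β (16384 * L) ≤ 1 / 2 ^ 24 :=
      (coldDefect_widen_24 r hβ00 L hL hdown).trans (by norm_num)
    refine ⟨16384 * L, by omega, ?_, coldPressureAt_of_le r hβ00 (by omega) hclimb⟩
    have : a β * ((16384 * L : ℕ) : ℝ) = 16384 * (a β * (L : ℝ)) := by push_cast; ring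
    rw [this]
    linarith
  refine gapInUnits_of_coldPressure_pinned r a ha ha0 (β₂ := max (max β₀ 0) β₁) (fun β hβ => ?_) (T := 16384 * T + 1)
    (β₆ := max (max β₀ 0) β₁) (fun β hβ => ?_)
  · obtain ⟨L, h1, -, h3⟩ := key β hβ
    exact ⟨L, h1, h3⟩
  · obtain ⟨L, h1, h2, h3⟩ := key β hβ
    have hle : (cpLength r.ρ β : ℝ) ≤ (L : ℝ) := by exact_mod_cast cpLength_le r.ρ β h1 h3
    have hmul := mul_le_mul_of_nonneg_left hle (ha β).le
    linarith

/-- **`M₂₄ ∧ CERT(1/48) ∧ N ⇒ IR` BY NAME — the few-percent edition of the line (both obligations at measurable depth).** -/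
theorem IR_of_ratchet24 (hM : BasinHeredity24SC) (hC : PinnedCertificatesAt (1 / 48)) (hN : IRnsc) :
    Summit.QuantumFields.YangMills.Theses.BalabanLadder.IR :=
  IR_of_cases (irsc_of_ratchet24 hM hC) hN

/-- {LEVEL DESCENT, CERT(1/48), N} ⇒ `IR` through the few-percent edition. -/
theorem IR_of_levelDescent48 (h : LevelDescentSC) (hC : PinnedCertificatesAt (1 / 48)) (hN : IRnsc) :
    Summit.QuantumFields.YangMills.Theses.BalabanLadder.IR :=
  IR_of_ratchet24 (basinHeredity24_of_levelDescent h) hC hN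

/-! ## §2k (rev 14) BY-NAME LINKS TO THE LANDED SEAM AND TO THE LEAD'S REGISTERED SLOT `PX(1/24) ∧ N`
The seam of §2j is LANDED (`Theorems/BalabanLadderIRThermalRatchetSeam.lean`, p611594) and factors through idea-14's pinned exit
`PinnedExit96.PinnedExitAt` (`Theorems/BalabanLadderIRPinnedExit96.lean`), which is the LEAD's registered slot of record
`pinned_exit_96_bill {stub_pinnedExit96 : PinnedExitAt (1/24), stub_irnsc}`.  So this line's two typed obligations IMPLY the LEAD's one stub by a
landed theorem: the thermal ratchet is exactly the split of PX(1/24) into cofinal decidable INSTANCES (CERT(1/48)) + the group-blind SIGN (M₂₄). -/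

/-- **M₂₄ ∧ CERT(1/48) ⇒ PX(1/24) BY NAME** (landed `ThermalRatchetSeam.pinnedExitAt_of_heredity_of_pinnedCertificates`; pure logic). -/
theorem pinnedExitAt24_of_ratchet (hM : BasinHeredity24SC) (hC : PinnedCertificatesAt (1 / 48)) :
    Summit.QuantumFields.YangMills.Cruxes.IR.PinnedExit96.PinnedExitAt (1 / 24) :=
  Summit.QuantumFields.YangMills.Cruxes.IR.ThermalRatchetSeam.pinnedExitAt_of_heredity_of_pinnedCertificates hM hC

/-- **The landed seam by name**: M₂₄ ∧ CERT(1/48) ⇒ `IRsc` is `ThermalRatchetSeam.irsc_of_ratchet24` (through `PinnedExit96.irsc_of_pinnedExit_le`). -/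
theorem irsc_of_ratchet24_landed (hM : BasinHeredity24SC) (hC : PinnedCertificatesAt (1 / 48)) : IRsc :=
  Summit.QuantumFields.YangMills.Cruxes.IR.ThermalRatchetSeam.irsc_of_ratchet24 hM hC

/-- **The line through the LEAD's slot, BY NAME**: M₂₄ → CERT(1/48) → N → `IR` is `PinnedExit96.IR_of ∘ pinnedExitAt24_of_ratchet`. -/
theorem IR_of_ratchet24_via_PX (hM : BasinHeredity24SC) (hC : PinnedCertificatesAt (1 / 48)) (hN : IRnsc) :
    Summit.QuantumFields.YangMills.Theses.BalabanLadder.IR :=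
  Summit.QuantumFields.YangMills.Cruxes.IR.PinnedExit96.IR_of (pinnedExitAt24_of_ratchet hM hC) hN

/-- Conversely the LEAD's stub gives this line's certificate stub at any tolerance (PX_θ is the case `βs = β`; the sign is then not needed):
`PinnedExitAt θ → PinnedCertificatesAt θ` (landed `ThermalRatchetSeam.pinnedCertificates_of_pinnedExitAt`). -/
theorem pinnedCertificatesAt_of_pinnedExitAt {θ : ℝ} (hP : Summit.QuantumFields.YangMills.Cruxes.IR.PinnedExit96.PinnedExitAt θ) :
    PinnedCertificatesAt θ :=
  Summit.QuantumFields.YangMills.Cruxes.IR.ThermalRatchetSeam.pinnedCertificates_of_pinnedExitAt hP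

/-- **H ⇔ H(1/24) by name** (landed `PurityClimb.floorToPuritySC_of_tolerance24`, p609146; idea-14's `PinnedExit96.rebaseH_iff` is the same fact
over its `FloorToPurityAt`): the floor handshake need only be proved at tolerance `1/24`. -/
theorem floorToPuritySC_iff_at24 : Summit.QuantumFields.YangMills.Cruxes.IR.PinnedExit96.FloorToPurityAt (1 / 24) ↔ FloorToPuritySC :=
  Summit.QuantumFields.YangMills.Cruxes.IR.PinnedExit96.rebaseH_iff

/-! ## §3 Registered stubs (the obligations; `sorry` ONLY here) and the composition by name
rev 13/14: the bill OF RECORD is the FEW-PERCENT edition `M₂₄ ∧ CERT(1/48) ∧ N` (§2j) — BOTH obligations posed at measurable purity depth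
(`δᶜ` at the percent level on ONE cold 4:1 box `L ≥ 8`): the sign `BasinHeredity24SC` (β-transport; summit-strength; B2 = the sign itself by
the integral method) and the cofinal decidable instances `PinnedCertificatesAt (1/48)`; the tree's rungs (`PurityClimb24`) do the climb to the
seam depth `2⁻²⁴`.  Earlier editions stay available as theorems over hypotheses: deep slack `IR_of_slackRatchet` (M♭₂ ∧ CERTᴴ(2⁻²⁵) ∧ N, rev 7),
`IR_of_slackRatchet24` (M♭₂ ∧ CERT(1/24) ∧ N, rev 12), X-edition `IR_of` (M♭ ∧ CERT♭ ∧ X ∧ N). -/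

/-- stub M₂₄ — FEW-PERCENT BASIN HEREDITY (rev 13; load-bearing; the SIGN): a `1/48`-pure cold box at the finer coupling is `1/24`-pure at
the coarser one, same lattice size (⟸ M_c ⟸ level descent: `basinHeredity24_of_levelDescent`; soft tail `1/96`: `basinHeredity24_of_softLevelDescent`). -/
theorem stub_basinHeredity : BasinHeredity24SC := by
  sorry

/-- stub CERT(1/48) — percent-level purity (`δᶜ ≤ 1/48`) certified on ONE cold 4:1 box of bounded physical size at some not-colder coupling, for a
cofinal set of couplings (decidable instances, certifier's choice of box; instrument class «THE NUMBER», never a prover target). -/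
theorem stub_pinnedCertificates : PinnedCertificatesAt (1 / 48) := by
  sorry

/-- stub N — the `π₁(G) ≠ 1` half of the crux, BY NAME (declared residual). -/
theorem stub_irnsc : IRnsc := by
  sorry

/-- The crux by name from the registered stubs (few-percent edition, rev 13; X-free). -/
theorem IR_of_stubs : Summit.QuantumFields.YangMills.Theses.BalabanLadder.IR :=
  IR_of_ratchet24 stub_basinHeredity stub_pinnedCertificates stub_irnsc

end Summit.QuantumFields.YangMills.Cruxes.IR.ThermalRatchet

end
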